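import Summits.KontsevichZagierPeriods.KontsevichZagierPeriods.Theses.HurwitzMicroSectors
import Summits.KontsevichZagierPeriods.KontsevichZagierPeriods.Theorems.HurwitzMicroSectorsNormalFormPrinciplePiBoxTransfer

/-! TTRL-lite variant V2238 of stmt-KontsevichZagierPeriods-3869

Variant V2238 = `stub_boxRigidity` (the leaf `BoxRigidity` of `NormalFormPrinciple`: two representations
on open unit boxes with integrands of KZ's rational shape and equal values are KZ-equivalent) under the
TWO-sided move `fix_nat:m=3; bound_nat:m'≤2` (left dimension frozen to `3`, right dimension `≤ 2`).
Verdict of the attempt seat: **open** — this file is the exact-strength certificate, not a proof of the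
variant. Unlike the one-sided moves (V2200, V2219, …, V2256, each equivalent to the whole leaf), a
two-sided bound IS a genuine weakening, and its strength depends only on the LARGEST dimension allowed:
for every `K` let `BoxVanishing K` say that a box-rational representation of dimension `K` and value `0`
is a relation. Then
* rigidity for ONE pair of dimensions `(K, k)` already gives `BoxVanishing K` and `BoxVanishing k`
  (compare with the zero representation on the other box: `boxVanishingDim_left/right_of_pair`);
* `BoxVanishing K` is monotone in `K` (pad by unit intervals, `pad_le`, tree: `boxVanishingDim_mono`);
* `BoxVanishing K` gives rigidity for ALL `m, m' ≤ K` (pad both to the `K`-box, subtract on it by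
  `sub_same`, tree; the difference has value `0` by soundness: `boxRigidityLe_of_boxVanishingDim`).
Hence `V2238 ⟺ BoxVanishing 3 ⟺ BoxRigidity for m, m' ≤ 3` (`stub_boxRigidity_var2238_iff_boxVanishing_three`,
`stub_boxRigidity_var2238_iff_le_three`); the same two lemmas settle every two-sided sibling
(`fix/bound m, m'` with maximum `D`) as `BoxVanishing D`. `BoxVanishing 1` is a theorem of the tree
(`boxRigidity_of_le_one`, Baker); `BoxVanishing 2` already asserts that EVERY vanishing `ℚ`-linear
combination of absolutely convergent `∫_{(0,1)²} P/Q` (values: `π²`, `log a · log b`, `π log 2`,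
`Li₂` at rationals, Catalan's `G`, `L(2,χ)` …) is generated by the four moves — open; `BoxVanishing 3`
(`ζ(3)`, `π³`, `Li₃` values …) contains it. Conversely `KontsevichZagierPeriods → V2238`
(`stub_boxRigidity_var2238_of_statement`), so a refutation of the variant would refute the Summit.
Source: M. Kontsevich, D. Zagier, *Periods* (2001), §1.2 Conjecture 1. Pure proof file, no definitions. -/

-- `Summit.<Summit>.<Problem>` is the tree's mandated summit-side namespace (CONVENTIONS §2); for this
-- single-conjunct summit the two coincide, so the duplicate is deliberate.
set_option linter.dupNamespace false

noncomputable section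

namespace Summit.KontsevichZagierPeriods.KontsevichZagierPeriods.Theorems

open MeasureTheory Set
open Literature.NumberTheory.Transcendental Literature.NumberTheory.Transcendental.KZ
open Summit.KontsevichZagierPeriods.KontsevichZagierPeriods.Theses.HurwitzMicroSectors
open Summit.KontsevichZagierPeriods.HurwitzMicroSectors.NormalFormPrinciple.PiBox
open Summit.KontsevichZagierPeriods.HurwitzMicroSectors.NormalFormPrinciple.PiBox.stub_boxCombineAux
  (pad_le sub_same)

/-! ## Two-sided dimension bounds: everything is `BoxVanishing` of the largest dimension -/

/-- **Rigidity for one pair of dimensions `(K, k)` ⇒ `BoxVanishing K`**: a box-rational representation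
of dimension `K` and value `0` is KZ-equivalent to the zero representation on the `k`-box (box-rational,
value `0`), which is itself a relation. [cite: KontsevichZagier2001, §1.2 Conjecture 1] -/
theorem boxVanishingDim_left_of_pair (K k : ℕ)
    (hrig : ∀ (N : IntegralRep K) (N' : IntegralRep k),
      N.domain = {x | ∀ i, x i ∈ Set.Ioo (0:ℝ) 1} → N.IsRational →
      N'.domain = {x | ∀ i, x i ∈ Set.Ioo (0:ℝ) 1} → N'.IsRational →
      N.value = N'.value → Equivalent N N')
    (N : IntegralRep K) (hNd : N.domain = {x | ∀ i, x i ∈ Set.Ioo (0:ℝ) 1}) (hNr : N.IsRational)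
    (hv : N.value = 0) : of N ∈ relations := by
  obtain ⟨Z, hZd, hZi⟩ := exists_zeroRep (isSemialgebraic_box k)
  have hZ : of Z ∈ relations := of_mem_relations_of_eqOn_zero Z (by simp [hZi, EqOn])
  have hZv : Z.value = 0 := by simp [IntegralRep.value, hZi]
  have hZr : Z.IsRational := ⟨0, 1, fun x _ => by simp, fun x _ => by simp [hZi]⟩
  have h : of N - of Z ∈ relations := hrig N Z hNd hNr hZd hZr (by rw [hv, hZv])
  simpa using relations.add_mem h hZ

/-- **Rigidity for one pair of dimensions `(K, k)` ⇒ `BoxVanishing k`** (the same from the other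
side). [cite: KontsevichZagier2001, §1.2 Conjecture 1] -/
theorem boxVanishingDim_right_of_pair (K k : ℕ)
    (hrig : ∀ (N : IntegralRep K) (N' : IntegralRep k),
      N.domain = {x | ∀ i, x i ∈ Set.Ioo (0:ℝ) 1} → N.IsRational →
      N'.domain = {x | ∀ i, x i ∈ Set.Ioo (0:ℝ) 1} → N'.IsRational →
      N.value = N'.value → Equivalent N N')
    (N' : IntegralRep k) (hN'd : N'.domain = {x | ∀ i, x i ∈ Set.Ioo (0:ℝ) 1}) (hN'r : N'.IsRational)
    (hv : N'.value = 0) : of N' ∈ relations := by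
  obtain ⟨Z, hZd, hZi⟩ := exists_zeroRep (isSemialgebraic_box K)
  have hZ : of Z ∈ relations := of_mem_relations_of_eqOn_zero Z (by simp [hZi, EqOn])
  have hZv : Z.value = 0 := by simp [IntegralRep.value, hZi]
  have hZr : Z.IsRational := ⟨0, 1, fun x _ => by simp, fun x _ => by simp [hZi]⟩
  have h : of Z - of N' ∈ relations := hrig Z N' hZd hZr hN'd hN'r (by rw [hv, hZv])
  have := relations.sub_mem hZ h
  rwa [sub_sub_cancel] at this

/-- **`BoxVanishing` is monotone in the dimension**: pad a box-rational representation of dimension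
`j ≤ K` by unit intervals to the `K`-box (`pad_le`: Newton–Leibniz moves plus null faces); the value is
unchanged by soundness. [cite: KontsevichZagier2001, §1.2] -/
theorem boxVanishingDim_mono {j K : ℕ} (hjK : j ≤ K)
    (hvan : ∀ (M : IntegralRep K), M.domain = {x | ∀ i, x i ∈ Set.Ioo (0:ℝ) 1} → M.IsRational →
      M.value = 0 → of M ∈ relations)
    (N : IntegralRep j) (hNd : N.domain = {x | ∀ i, x i ∈ Set.Ioo (0:ℝ) 1}) (hNr : N.IsRational)
    (hv : N.value = 0) : of N ∈ relations := by
  obtain ⟨R, hRd, hRr, hR⟩ := pad_le hjK N hNd hNr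
  have hRv : R.value = 0 := by
    have e := relations_le_ker_eval_holds hR
    rw [AddMonoidHom.mem_ker, map_sub, eval_of, eval_of, hv, zero_sub, neg_eq_zero] at e
    exact e
  have := relations.add_mem hR (hvan R hRd hRr hRv)
  rwa [sub_add_cancel] at this

/-- **`BoxVanishing K` ⇒ rigidity for all dimensions `m, m' ≤ K`**: pad both representations to the
`K`-box (`pad_le`), subtract the integrands there (`sub_same`, rule 1b); the difference is box-rational of
value `0` by soundness, hence a relation. [cite: KontsevichZagier2001, §1.2 Conjecture 1] -/
theorem boxRigidityLe_of_boxVanishingDim (K : ℕ)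
    (hvan : ∀ (M : IntegralRep K), M.domain = {x | ∀ i, x i ∈ Set.Ioo (0:ℝ) 1} → M.IsRational →
      M.value = 0 → of M ∈ relations) :
    ∀ (m m' : ℕ) (N : IntegralRep m) (N' : IntegralRep m'), m ≤ K → m' ≤ K →
      N.domain = {x | ∀ i, x i ∈ Set.Ioo (0:ℝ) 1} → N.IsRational →
      N'.domain = {x | ∀ i, x i ∈ Set.Ioo (0:ℝ) 1} → N'.IsRational →
      N.value = N'.value → Equivalent N N' := by
  intro m m' N N' hm hm' hNd hNr hN'd hN'r hv
  obtain ⟨R₁, h₁d, h₁r, h₁⟩ := pad_le hm N hNd hNr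
  obtain ⟨R₂, h₂d, h₂r, h₂⟩ := pad_le hm' N' hN'd hN'r
  obtain ⟨M, hMd, hMr, hM⟩ := sub_same R₁ R₂ h₁d h₁r h₂d h₂r
  have hMv : M.value = 0 := by
    have e₁ := relations_le_ker_eval_holds h₁
    have e₂ := relations_le_ker_eval_holds h₂
    have e := relations_le_ker_eval_holds hM
    rw [AddMonoidHom.mem_ker, map_sub, eval_of, eval_of, sub_eq_zero] at e₁ e₂
    rw [AddMonoidHom.mem_ker, map_sub, map_sub, eval_of, eval_of, eval_of, ← e₁, ← e₂, hv, sub_self,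
      zero_sub, neg_eq_zero] at e
    exact e
  have e : of N - of N' = (of N - of R₁) - (of N' - of R₂) + (of R₁ - of R₂ - of M) + of M := by abel
  show of N - of N' ∈ relations
  rw [e]
  exact relations.add_mem (relations.add_mem (relations.sub_mem h₁ h₂) hM) (hvan M hMd hMr hMv)

/-! ## The variant V2238 itself: exactly `BoxVanishing 3` -/

/-- **V2238 ⟺ `BoxVanishing 3`**: (⇒) the pair `(3, 0)` is allowed (`0 ≤ 2`), so
`boxVanishingDim_left_of_pair`; (⇐) `boxRigidityLe_of_boxVanishingDim 3` with `m = 3`, `m' ≤ 2 ≤ 3`.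
[cite: KontsevichZagier2001, §1.2 Conjecture 1] -/
theorem stub_boxRigidity_var2238_iff_boxVanishing_three :
    (∀ (m' : ℕ) (N : IntegralRep 3) (N' : IntegralRep m'), m' ≤ 2 → N.domain = {x | ∀ i, x i ∈ Set.Ioo (0:ℝ) 1} → N.IsRational → N'.domain = {x | ∀ i, x i ∈ Set.Ioo (0:ℝ) 1} → N'.IsRational → N.value = N'.value → Equivalent N N') ↔
    (∀ (M : IntegralRep 3), M.domain = {x | ∀ i, x i ∈ Set.Ioo (0:ℝ) 1} → M.IsRational →
      M.value = 0 → of M ∈ relations) :=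
  ⟨fun h => boxVanishingDim_left_of_pair 3 0 fun N N' => h 0 N N' (Nat.zero_le 2),
    fun hvan m' N N' hm' => boxRigidityLe_of_boxVanishingDim 3 hvan 3 m' N N' le_rfl (hm'.trans (by norm_num))⟩

/-- **V2238 ⟺ `BoxRigidity` for all `m, m' ≤ 3`** (so V2238 coincides with the two-sided variant
`bound_nat:m≤3; bound_nat:m'≤3` and with `fix_nat:m=3; fix_nat:m'=k` for every `k ≤ 3`).
[cite: KontsevichZagier2001, §1.2 Conjecture 1] -/
theorem stub_boxRigidity_var2238_iff_le_three :
    (∀ (m' : ℕ) (N : IntegralRep 3) (N' : IntegralRep m'), m' ≤ 2 → N.domain = {x | ∀ i, x i ∈ Set.Ioo (0:ℝ) 1} → N.IsRational → N'.domain = {x | ∀ i, x i ∈ Set.Ioo (0:ℝ) 1} → N'.IsRational → N.value = N'.value → Equivalent N N') ↔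
    (∀ (m m' : ℕ) (N : IntegralRep m) (N' : IntegralRep m'), m ≤ 3 → m' ≤ 3 →
      N.domain = {x | ∀ i, x i ∈ Set.Ioo (0:ℝ) 1} → N.IsRational →
      N'.domain = {x | ∀ i, x i ∈ Set.Ioo (0:ℝ) 1} → N'.IsRational →
      N.value = N'.value → Equivalent N N') := by
  rw [stub_boxRigidity_var2238_iff_boxVanishing_three]
  exact ⟨fun hvan => boxRigidityLe_of_boxVanishingDim 3 hvan,
    fun h => boxVanishingDim_left_of_pair 3 3 fun N N' => h 3 3 N N' le_rfl le_rfl⟩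

/-- **V2238 ⇒ `BoxVanishing` in every dimension `≤ 3`** (monotonicity), in particular the dimension-`2`
statement that every vanishing `ℚ`-combination of absolutely convergent `∫_{(0,1)²} P/Q` is generated by
the moves. [cite: KontsevichZagier2001, §1.2 Conjecture 1] -/
theorem boxVanishing_le_three_of_stub_boxRigidity_var2238
    (h : ∀ (m' : ℕ) (N : IntegralRep 3) (N' : IntegralRep m'), m' ≤ 2 → N.domain = {x | ∀ i, x i ∈ Set.Ioo (0:ℝ) 1} → N.IsRational → N'.domain = {x | ∀ i, x i ∈ Set.Ioo (0:ℝ) 1} → N'.IsRational → N.value = N'.value → Equivalent N N')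
    {j : ℕ} (hj : j ≤ 3) (N : IntegralRep j) (hNd : N.domain = {x | ∀ i, x i ∈ Set.Ioo (0:ℝ) 1})
    (hNr : N.IsRational) (hv : N.value = 0) : of N ∈ relations :=
  boxVanishingDim_mono hj (stub_boxRigidity_var2238_iff_boxVanishing_three.1 h) N hNd hNr hv

/-- **The parent leaf ⇒ V2238** (specialisation). [cite: KontsevichZagier2001, §1.2 Conjecture 1] -/
theorem stub_boxRigidity_var2238_of_parent
    (h : ∀ (m m' : ℕ) (N : IntegralRep m) (N' : IntegralRep m'), N.domain = {x | ∀ i, x i ∈ Set.Ioo (0:ℝ) 1} → N.IsRational → N'.domain = {x | ∀ i, x i ∈ Set.Ioo (0:ℝ) 1} → N'.IsRational → N.value = N'.value → Equivalent N N') :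
    ∀ (m' : ℕ) (N : IntegralRep 3) (N' : IntegralRep m'), m' ≤ 2 → N.domain = {x | ∀ i, x i ∈ Set.Ioo (0:ℝ) 1} → N.IsRational → N'.domain = {x | ∀ i, x i ∈ Set.Ioo (0:ℝ) 1} → N'.IsRational → N.value = N'.value → Equivalent N N' :=
  fun m' N N' _ => h 3 m' N N'

/-- **`KontsevichZagierPeriods ⇒ V2238`**: the variant is a special case of Conjecture 1 for the tree's
calculus (`leaves_of_statement`) — so a refutation of the variant would refute the Summit.
[cite: KontsevichZagier2001, §1.2 Conjecture 1] -/
theorem stub_boxRigidity_var2238_of_statement (h : _root_.KontsevichZagierPeriods) :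
    ∀ (m' : ℕ) (N : IntegralRep 3) (N' : IntegralRep m'), m' ≤ 2 → N.domain = {x | ∀ i, x i ∈ Set.Ioo (0:ℝ) 1} → N.IsRational → N'.domain = {x | ∀ i, x i ∈ Set.Ioo (0:ℝ) 1} → N'.IsRational → N.value = N'.value → Equivalent N N' :=
  stub_boxRigidity_var2238_of_parent (leaves_of_statement h).1

end Summit.KontsevichZagierPeriods.KontsevichZagierPeriods.Theorems

end
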